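import Literature.Analysis.FluidPDE.SwirlMaximumPrinciple
import HarnessLib

/-!
# A Liouville lemma for drift–heat equations with a drift tangent to spheres

Support file for item `stmt-NavierStokesRegularity-1365` (`SphereTangentLiouville`, route
`CorkscrewDynamo`, NavierStokesRegularity). The maximum-principle step of the toroidal anti-dynamo
argument, in physical variables. Let `g : (−∞, 0) × ℝ³ → ℝ` be a classical solution of
`∂ₜg = Δg − Dg[V]` (`C²` slices, jointly continuous, differentiable in time) whose drift `V` is
TANGENT to the spheres about the origin, `⟪x, V(t, x)⟫ = 0` (no bound on `V` is needed), and
assume the scale-invariant linear growth bound `|g(t, x)| ≤ C₁ |x| / (−t)`. Then `g ≡ 0`.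

Proof: radial functions are invisible to a tangent drift (`D(φ(|x|²))[V] = 2φ'⟪x, V⟫ = 0`), so
`B(t, x) = K(|x|² + 6(t − t₀) + ρ²) + ε e^{6(t−t₀)}(1 + |x|²)` is a supersolution; with
`K = C₁/(2ρ(−t₀))` it dominates `g(t₀, ·)` (`2ρ|x| ≤ |x|² + ρ²`) and, on a large sphere
`|x| = R ≥ C₁/((−t₁)ε)`, it dominates `g` on `[t₀, t₁]`; the tree's weak parabolic maximum
principle (`weak_max_principle`, Lieberman Ch. II) gives `g(t₁, x₁) ≤ B(t₁, x₁)`; let `ε → 0`,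
then `ρ = √(−t₀)`, `t₀ → −∞`: `K(|x₁|² + 6(t₁ − t₀) + ρ²) ≤ C₁(|x₁|² + 7(−t₀))/(2(−t₀)^{3/2}) → 0`.

* `tangentDrift_le_barrier` — the comparison on `[t₀, t₁]`;
* `tangentDrift_nonpos` — `g ≤ 0`;
* `tangentDrift_eq_zero` — `g = 0` (apply the previous to `±g`).
-/

noncomputable section

open MeasureTheory Set Function Filter InnerProductSpace Metric
open scoped RealInnerProductSpace Topology Laplacian
open Literature.Analysis Literature.Analysis.FluidPDE

set_option linter.dupNamespace false

namespace Summit.NavierStokesRegularity.NavierStokesRegularity.Theorems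

/-- The constant of a bound `|g(t, x)| ≤ C₁|x|/(−t)` on `(−∞, 0) × ℝ³` is nonnegative. -/
theorem const_nonneg_of_abs_le_mul_norm_div {g : ℝ → EuclideanSpace ℝ (Fin 3) → ℝ} {C₁ : ℝ}
    (hbd : ∀ t < 0, ∀ x, |g t x| ≤ C₁ * ‖x‖ / (-t)) : 0 ≤ C₁ := by
  obtain ⟨e, he⟩ := exists_norm_eq (EuclideanSpace ℝ (Fin 3)) zero_le_one
  have h := hbd (-1) (by norm_num) e
  rw [he, mul_one, neg_neg, div_one] at h
  exact (abs_nonneg _).trans h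

/-- **Comparison with the radial barrier.** Under the hypotheses of the module docstring, for
`t₀ < t₁ < 0`, `ρ, ε > 0` and every `x₁`,
`g(t₁, x₁) ≤ C₁/(2ρ(−t₀)) (|x₁|² + 6(t₁ − t₀) + ρ²) + ε e^{6(t₁−t₀)} (1 + |x₁|²)`. -/
theorem tangentDrift_le_barrier
    {g gt : ℝ → EuclideanSpace ℝ (Fin 3) → ℝ}
    {Vd : ℝ → EuclideanSpace ℝ (Fin 3) → EuclideanSpace ℝ (Fin 3)} {C₁ : ℝ}
    (hg2 : ∀ t < 0, ContDiff ℝ 2 (g t))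
    (hgc : ContinuousOn (uncurry g) (Iio 0 ×ˢ univ))
    (hgt : ∀ t < 0, ∀ x, HasDerivAt (fun s => g s x) (gt t x) t)
    (heq : ∀ t < 0, ∀ x, gt t x = (Δ (g t)) x - fderiv ℝ (g t) x (Vd t x))
    (hV : ∀ t < 0, ∀ x, ⟪x, Vd t x⟫ = 0)
    (hbd : ∀ t < 0, ∀ x, |g t x| ≤ C₁ * ‖x‖ / (-t))
    {t₀ t₁ : ℝ} (h01 : t₀ < t₁) (ht₁ : t₁ < 0) {ρ ε : ℝ} (hρ : 0 < ρ) (hε : 0 < ε)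
    (x₁ : EuclideanSpace ℝ (Fin 3)) :
    g t₁ x₁ ≤ C₁ / (2 * ρ * (-t₀)) * (‖x₁‖ ^ 2 + 6 * (t₁ - t₀) + ρ ^ 2)
      + ε * Real.exp (6 * (t₁ - t₀)) * (1 + ‖x₁‖ ^ 2) := by
  have ht₀ : t₀ < 0 := h01.trans ht₁
  have hnt₀ : 0 < -t₀ := by linarith
  have hnt₁ : 0 < -t₁ := by linarith
  have hC₁ : 0 ≤ C₁ := const_nonneg_of_abs_le_mul_norm_div hbd
  set Kc : ℝ := C₁ / (2 * ρ * (-t₀)) with hKc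
  have hKc0 : 0 ≤ Kc := by positivity
  -- the radius of the ball
  set R : ℝ := max ‖x₁‖ (C₁ / ((-t₁) * ε)) with hR
  have hx₁R : ‖x₁‖ ≤ R := le_max_left _ _
  have hR0 : 0 ≤ R := (norm_nonneg _).trans hx₁R
  -- the comparison function and its time derivative
  set w : ℝ → EuclideanSpace ℝ (Fin 3) → ℝ := fun t x =>
    g t x - (Kc * (‖x‖ ^ 2 + 6 * (t - t₀) + ρ ^ 2) +
      ε * Real.exp (6 * (t - t₀)) * (1 + ‖x‖ ^ 2)) with hw
  set wₜ : ℝ → EuclideanSpace ℝ (Fin 3) → ℝ := fun t x =>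
    gt t x - (6 * Kc + 6 * (ε * Real.exp (6 * (t - t₀))) * (1 + ‖x‖ ^ 2)) with hwₜ
  -- the barrier slice in the form `M + c (1 + |x|²)`
  have hbar : ∀ (t : ℝ) (x : EuclideanSpace ℝ (Fin 3)), Kc * (‖x‖ ^ 2 + 6 * (t - t₀) + ρ ^ 2) +
      ε * Real.exp (6 * (t - t₀)) * (1 + ‖x‖ ^ 2) =
      Kc * (6 * (t - t₀) + ρ ^ 2 - 1) + (Kc + ε * Real.exp (6 * (t - t₀))) * (1 + ‖x‖ ^ 2) := by
    intro t x; ring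
  have hwfun : ∀ t, w t = fun x => g t x - (Kc * (6 * (t - t₀) + ρ ^ 2 - 1) +
      (Kc + ε * Real.exp (6 * (t - t₀))) * (1 + ‖x‖ ^ 2)) := by
    intro t; funext x; simp only [hw, hbar]
  set K : Set (EuclideanSpace ℝ (Fin 3)) := closedBall 0 R with hK
  set U : Set (EuclideanSpace ℝ (Fin 3)) := ball 0 R with hU
  have hKcpt : IsCompact K := isCompact_closedBall _ _
  have hUo : IsOpen U := isOpen_ball
  have hUK : U ⊆ K := ball_subset_closedBall
  -- (a) joint continuity on `[t₀, t₁] × K`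
  have hc : ContinuousOn (uncurry w) (Icc t₀ t₁ ×ˢ K) := by
    have hgc' : ContinuousOn (uncurry g) (Icc t₀ t₁ ×ˢ K) :=
      hgc.mono (prod_mono (fun t ht => lt_of_le_of_lt ht.2 ht₁) (subset_univ _))
    have h2 : Continuous fun p : ℝ × EuclideanSpace ℝ (Fin 3) =>
        Kc * (‖p.2‖ ^ 2 + 6 * (p.1 - t₀) + ρ ^ 2) +
          ε * Real.exp (6 * (p.1 - t₀)) * (1 + ‖p.2‖ ^ 2) := by
      fun_prop
    exact hgc'.sub h2.continuousOn
  -- (b) smooth slices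
  have h2 : ∀ t ∈ Ioc t₀ t₁, ContDiff ℝ 2 (w t) := by
    intro t ht
    rw [hwfun t]
    exact (hg2 t (lt_of_le_of_lt ht.2 ht₁)).sub (contDiff_barrier _ _)
  -- (c) the time derivative
  have ht : ∀ t ∈ Ioc t₀ t₁, ∀ x ∈ U, HasDerivWithinAt (fun s => w s x) (wₜ t x) (Icc t₀ t) t := by
    intro t ht x _
    have htneg : t < 0 := lt_of_le_of_lt ht.2 ht₁
    have h1 : HasDerivAt (fun s => Kc * (‖x‖ ^ 2 + 6 * (s - t₀) + ρ ^ 2)) (Kc * 6) t := by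
      have := (((hasDerivAt_id t).sub_const t₀).const_mul 6).const_add (‖x‖ ^ 2)
      have := (this.add_const (ρ ^ 2)).const_mul Kc
      simpa using this
    have h2 : HasDerivAt (fun s => ε * Real.exp (6 * (s - t₀)) * (1 + ‖x‖ ^ 2))
        (ε * (Real.exp (6 * (t - t₀)) * 6) * (1 + ‖x‖ ^ 2)) t := by
      have h := (((hasDerivAt_id t).sub_const t₀).const_mul 6).exp
      have := (h.const_mul ε).mul_const (1 + ‖x‖ ^ 2)
      simpa using this
    have h := ((hgt t htneg x).sub (h1.add h2)).hasDerivWithinAt (s := Icc t₀ t)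
    simp only [hw, hwₜ]
    exact h.congr_deriv (by ring)
  -- (d) the sub-solution implication
  have hsub : ∀ t ∈ Ioc t₀ t₁, ∀ x ∈ U, fderiv ℝ (w t) x = 0 → (Δ (w t)) x ≤ 0 → wₜ t x ≤ 0 := by
    intro t ht x _ hgrad hlap
    have htneg : t < 0 := lt_of_le_of_lt ht.2 ht₁
    set c : ℝ := Kc + ε * Real.exp (6 * (t - t₀)) with hc
    set M : ℝ := Kc * (6 * (t - t₀) + ρ ^ 2 - 1) with hM
    have hgd : DifferentiableAt ℝ (g t) x :=
      ((hg2 t htneg).differentiable (by norm_num)) x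
    have hB := hasFDerivAt_barrier M c x
    have hwderiv : HasFDerivAt (w t) (fderiv ℝ (g t) x -
        c • ((2 : ℕ) • (innerSL ℝ x : EuclideanSpace ℝ (Fin 3) →L[ℝ] ℝ))) x := by
      rw [hwfun t]
      exact hgd.hasFDerivAt.sub hB
    have hDeq : fderiv ℝ (g t) x = c • ((2 : ℕ) • (innerSL ℝ x : EuclideanSpace ℝ (Fin 3) →L[ℝ] ℝ)) := by
      have := hwderiv.fderiv
      rw [hgrad] at this
      exact sub_eq_zero.1 this.symm
    have hDV : fderiv ℝ (g t) x (Vd t x) = 0 := by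
      have := congrArg (fun L : EuclideanSpace ℝ (Fin 3) →L[ℝ] ℝ => L (Vd t x)) hDeq
      simp only [_root_.FunLike.coe_smul, Pi.smul_apply, innerSL_apply_apply, hV t htneg x,
        smul_zero] at this
      exact this
    have hΔeq : (Δ (w t)) x = (Δ (g t)) x - 6 * c := by
      have h1 : ContDiffAt ℝ 2 (g t) x := (hg2 t htneg).contDiffAt
      have h2 : ContDiffAt ℝ 2 (fun y : EuclideanSpace ℝ (Fin 3) => (M + c * (1 + ‖y‖ ^ 2) : ℝ)) x :=
        (contDiff_barrier M c).contDiffAt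
      have h4 := h1.laplacian_sub h2
      have hfun : w t = (g t) - fun y : EuclideanSpace ℝ (Fin 3) => (M + c * (1 + ‖y‖ ^ 2) : ℝ) := by
        rw [hwfun t]; rfl
      rw [hfun, h4, laplacian_barrier]
    have hΔ : (Δ (g t)) x ≤ 6 * c := by rw [hΔeq] at hlap; linarith
    have e3 : wₜ t x = (Δ (g t)) x - 6 * c - 6 * (ε * Real.exp (6 * (t - t₀))) * ‖x‖ ^ 2 := by
      simp only [hwₜ, hc, heq t htneg x, hDV]
      ring
    rw [e3]
    have : 0 ≤ 6 * (ε * Real.exp (6 * (t - t₀))) * ‖x‖ ^ 2 := by positivity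
    linarith
  -- (e) the bottom `t = t₀`
  have hbot : ∀ x ∈ K, w t₀ x ≤ 0 := by
    intro x _
    have h1 : g t₀ x ≤ C₁ * ‖x‖ / (-t₀) := (le_abs_self _).trans (hbd t₀ ht₀ x)
    have h2 : C₁ * ‖x‖ / (-t₀) = Kc * (2 * ρ * ‖x‖) := by
      rw [hKc]; field_simp
    have h3 : Kc * (2 * ρ * ‖x‖) ≤ Kc * (‖x‖ ^ 2 + ρ ^ 2) := by
      refine mul_le_mul_of_nonneg_left ?_ hKc0
      nlinarith [two_mul_le_add_sq ρ ‖x‖]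
    have h4 : 0 ≤ ε * Real.exp (6 * (t₀ - t₀)) * (1 + ‖x‖ ^ 2) := by positivity
    simp only [hw, sub_self, mul_zero, add_zero] at h4 ⊢
    linarith
  -- (f) the sphere `|x| = R`
  have hlat : ∀ t ∈ Icc t₀ t₁, ∀ x ∈ K \ U, w t x ≤ 0 := by
    intro t ht x hx
    have htneg : t < 0 := lt_of_le_of_lt ht.2 ht₁
    have hxR : ‖x‖ = R := by
      have h1 : ‖x‖ ≤ R := mem_closedBall_zero_iff.1 hx.1
      have h2 : R ≤ ‖x‖ := by simpa [hU] using hx.2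
      exact le_antisymm h1 h2
    -- `g ≤ C₁ R/(−t₁) ≤ ε R²`
    have h1 : g t x ≤ C₁ * R / (-t₁) := by
      refine ((le_abs_self _).trans (hbd t htneg x)).trans ?_
      rw [hxR]
      exact div_le_div_of_nonneg_left (by positivity) hnt₁ (by linarith [ht.2])
    have h2 : C₁ * R / (-t₁) ≤ ε * R ^ 2 := by
      have hR' : C₁ / ((-t₁) * ε) ≤ R := le_max_right _ _
      rw [div_le_iff₀ (by positivity)] at hR'
      rw [div_le_iff₀ hnt₁]
      nlinarith
    have h3 : ε * R ^ 2 ≤ ε * Real.exp (6 * (t - t₀)) * (1 + ‖x‖ ^ 2) := by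
      rw [hxR]
      have hexp : 1 ≤ Real.exp (6 * (t - t₀)) := Real.one_le_exp (by linarith [ht.1])
      calc ε * R ^ 2 ≤ ε * 1 * (1 + R ^ 2) := by nlinarith [hε.le, sq_nonneg R]
        _ ≤ ε * Real.exp (6 * (t - t₀)) * (1 + R ^ 2) := by
          apply mul_le_mul_of_nonneg_right _ (by positivity)
          exact mul_le_mul_of_nonneg_left hexp hε.le
    have h4 : 0 ≤ Kc * (‖x‖ ^ 2 + 6 * (t - t₀) + ρ ^ 2) := by
      refine mul_nonneg hKc0 ?_
      nlinarith [ht.1, sq_nonneg ‖x‖, sq_nonneg ρ]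
    simp only [hw]
    linarith
  have key := weak_max_principle hKcpt hUo hUK hc h2 ht hsub hbot hlat t₁
    ⟨h01.le, le_rfl⟩ x₁ (mem_closedBall_zero_iff.2 hx₁R)
  simp only [hw] at key
  linarith


/-- **`g ≤ 0`.** Under the hypotheses of the module docstring, `g(t₁, x₁) ≤ 0` for all `t₁ < 0`:
in `tangentDrift_le_barrier` take `t₀ = −N²`, `ρ = N`, `ε = η/(2e^{6(t₁−t₀)}(1+|x₁|²))` with `N`
large, so that the right-hand side is at most `C₁(|x₁|² + 7)/(2N) + η/2 ≤ η`. -/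
theorem tangentDrift_nonpos
    {g gt : ℝ → EuclideanSpace ℝ (Fin 3) → ℝ}
    {Vd : ℝ → EuclideanSpace ℝ (Fin 3) → EuclideanSpace ℝ (Fin 3)} {C₁ : ℝ}
    (hg2 : ∀ t < 0, ContDiff ℝ 2 (g t))
    (hgc : ContinuousOn (uncurry g) (Iio 0 ×ˢ univ))
    (hgt : ∀ t < 0, ∀ x, HasDerivAt (fun s => g s x) (gt t x) t)
    (heq : ∀ t < 0, ∀ x, gt t x = (Δ (g t)) x - fderiv ℝ (g t) x (Vd t x))
    (hV : ∀ t < 0, ∀ x, ⟪x, Vd t x⟫ = 0)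
    (hbd : ∀ t < 0, ∀ x, |g t x| ≤ C₁ * ‖x‖ / (-t)) :
    ∀ t < 0, ∀ x, g t x ≤ 0 := by
  intro t₁ ht₁ x₁
  have hC₁ : 0 ≤ C₁ := const_nonneg_of_abs_le_mul_norm_div hbd
  refine le_of_forall_pos_le_add fun η hη => ?_
  -- the large parameter
  set A : ℝ := C₁ * (‖x₁‖ ^ 2 + 7) with hA
  have hA0 : 0 ≤ A := by positivity
  set N : ℝ := max 1 (max (Real.sqrt (-t₁) + 1) (A / η)) with hN
  have hN1 : 1 ≤ N := le_max_left _ _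
  have hN0 : 0 < N := lt_of_lt_of_le one_pos hN1
  have hNs : Real.sqrt (-t₁) + 1 ≤ N := (le_max_left _ _).trans (le_max_right _ _)
  have hNA : A / η ≤ N := (le_max_right _ _).trans (le_max_right _ _)
  set t₀ : ℝ := -N ^ 2 with ht₀
  have h01 : t₀ < t₁ := by
    have hs : 0 ≤ Real.sqrt (-t₁) := Real.sqrt_nonneg _
    have hsq : Real.sqrt (-t₁) ^ 2 = -t₁ := Real.sq_sqrt (by linarith)
    have : Real.sqrt (-t₁) < N := by linarith
    nlinarith
  have hnt₀ : -t₀ = N ^ 2 := by rw [ht₀, neg_neg]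
  set e : ℝ := Real.exp (6 * (t₁ - t₀)) * (1 + ‖x₁‖ ^ 2) with he
  have he0 : 0 < e := by positivity
  set ε : ℝ := η / (2 * e) with hε
  have hε0 : 0 < ε := by positivity
  have key := tangentDrift_le_barrier hg2 hgc hgt heq hV hbd h01 ht₁ hN0 hε0 x₁
  -- the `ε`-term is `η/2`
  have h2 : ε * Real.exp (6 * (t₁ - t₀)) * (1 + ‖x₁‖ ^ 2) = η / 2 := by
    rw [mul_assoc, ← he, hε]
    field_simp
  -- the barrier term is at most `A/(2N) ≤ η/2`
  have h1 : C₁ / (2 * N * (-t₀)) * (‖x₁‖ ^ 2 + 6 * (t₁ - t₀) + N ^ 2) ≤ A / (2 * N) := by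
    rw [hnt₀]
    have hle : ‖x₁‖ ^ 2 + 6 * (t₁ - t₀) + N ^ 2 ≤ (‖x₁‖ ^ 2 + 7) * N ^ 2 := by
      rw [ht₀]
      have hx : ‖x₁‖ ^ 2 ≤ ‖x₁‖ ^ 2 * N ^ 2 := by
        have : 1 ≤ N ^ 2 := by nlinarith
        nlinarith [sq_nonneg ‖x₁‖]
      nlinarith
    calc C₁ / (2 * N * N ^ 2) * (‖x₁‖ ^ 2 + 6 * (t₁ - t₀) + N ^ 2)
        ≤ C₁ / (2 * N * N ^ 2) * ((‖x₁‖ ^ 2 + 7) * N ^ 2) :=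
          mul_le_mul_of_nonneg_left hle (by positivity)
      _ = A / (2 * N) := by rw [hA]; field_simp
  have h3 : A / (2 * N) ≤ η / 2 := by
    rw [div_le_iff₀ hη] at hNA
    rw [div_le_div_iff₀ (by positivity) two_pos]
    nlinarith
  linarith

/-- **The Liouville lemma: `g = 0`.** A classical solution `g` of `∂ₜg = Δg − Dg[V]` on
`(−∞, 0) × ℝ³` (`C²` slices, jointly continuous, differentiable in time) with a drift `V`
tangent to the spheres about the origin and the scale-invariant growth bound
`|g(t, x)| ≤ C₁|x|/(−t)` vanishes identically (`tangentDrift_nonpos` for `g` and for `−g`). -/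
theorem tangentDrift_eq_zero
    {g gt : ℝ → EuclideanSpace ℝ (Fin 3) → ℝ}
    {Vd : ℝ → EuclideanSpace ℝ (Fin 3) → EuclideanSpace ℝ (Fin 3)} {C₁ : ℝ}
    (hg2 : ∀ t < 0, ContDiff ℝ 2 (g t))
    (hgc : ContinuousOn (uncurry g) (Iio 0 ×ˢ univ))
    (hgt : ∀ t < 0, ∀ x, HasDerivAt (fun s => g s x) (gt t x) t)
    (heq : ∀ t < 0, ∀ x, gt t x = (Δ (g t)) x - fderiv ℝ (g t) x (Vd t x))
    (hV : ∀ t < 0, ∀ x, ⟪x, Vd t x⟫ = 0)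
    (hbd : ∀ t < 0, ∀ x, |g t x| ≤ C₁ * ‖x‖ / (-t)) :
    ∀ t < 0, ∀ x, g t x = 0 := by
  have hle := tangentDrift_nonpos hg2 hgc hgt heq hV hbd
  -- the hypotheses for `-g`
  have hneg : ∀ t, (fun x => -g t x) = -(g t) := fun t => rfl
  have hg2' : ∀ t < 0, ContDiff ℝ 2 fun x => -g t x := fun t ht => (hg2 t ht).neg
  have hgc' : ContinuousOn (uncurry fun t x => -g t x) (Iio 0 ×ˢ univ) := hgc.neg
  have hgt' : ∀ t < 0, ∀ x, HasDerivAt (fun s => -g s x) (-gt t x) t :=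
    fun t ht x => (hgt t ht x).neg
  have heq' : ∀ t < 0, ∀ x, -gt t x = (Δ fun y => -g t y) x - fderiv ℝ (fun y => -g t y) x (Vd t x) := by
    intro t ht x
    rw [hneg, InnerProductSpace.laplacian_neg, fderiv_neg, heq t ht x]
    simp only [Pi.neg_apply, _root_.neg_apply]
    ring
  have hbd' : ∀ t < 0, ∀ x, |(-g t x)| ≤ C₁ * ‖x‖ / (-t) := fun t ht x => by
    rw [abs_neg]; exact hbd t ht x
  have hge := tangentDrift_nonpos (g := fun t x => -g t x) (gt := fun t x => -gt t x)
    hg2' hgc' hgt' heq' hV hbd'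
  intro t ht x
  have h1 := hle t ht x
  have h2 := hge t ht x
  linarith

end Summit.NavierStokesRegularity.NavierStokesRegularity.Theorems
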